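import Mathlib
import Literature.NumberTheory.Transcendental.PadicLogPrincipalUnits
import Literature.NumberTheory.LocalFields.PadicExpLogHomomorphisms
import Literature.NumberTheory.EllipticCurves.PAdicOneVariableSupportOfColemanTraceTwo
import Literature.NumberTheory.GaloisRepresentations.LubinTateComparisonAddPoints
import Literature.NumberTheory.GaloisRepresentations.LubinTateColemanRelativeInterpolationTwo
import HarnessLib

/-!
# k3-g40 — DECOMPOSITION of R219 «READ₂» (STUB-PLAN v7.3: the ONLY open node of road B′'s table atom) into sub-stubs
# with PROVED glue, with R221 «EVAL₂» CLOSED IN KERNEL by a change of currency: the reading witness is `Λ₂` of an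
# INTEGRAL series (`Λ₂ = ½·log(1+2X) ∈ ℤ₂⟦X⟧`), so evaluation is the tree's `evS`/`evS_subst` + the closed-ball Mercator sum

Stub: `stub_heegnerIndexLowerAtTwo` (skeleton `f2bd84c0…`, crux `SplitBadTwoLowerHalfOfFacts`, route PrintCf2).
Placement (JUNCTION J, π4): B′ = construction-world credit for the normalised family `prints_family_def_two`; this file
does NOT close frame (i-c), does NOT touch A′, proves NEITHER the stub NOR the crux, and BSD is NOT proved by any of it.

THE CUT (v7.3 names).  READ₂ = `RamifiedReading` for the torsion-value table `V(j) = A_b(ζ^j − 1)` of the bounded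
`D`-primitive `A_b` of `H_b` (R218 CLOSED, row 115; `A_b = L_b + const`, `L_b` = the series-side witness certified a
primitive by R218a′ CHAIN-RULE₂).  Row 114/115 type `L_b` through Mathlib's FORMAL `logOf` and price its evaluation as
R221 «EVAL₂» (S): "formal `logOf g` evaluated on the open disc = `logU` of the value + subst/eval commutation; Mathlib has
no evaluation API for `logOf`".  THIS FILE: the series whose `logOf` is read is `≡ 1 (mod 2)` in BOTH presentations
(REFL: `Q_β = g_β/τ_E g_β ≡ 1 (mod π')`, k3-g39's PROVED `reflQuot_sub_one_mem`/H6; FROB: `g² = (g^φ∘f')(1+2y)`, k1-g37),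
and `logOf(1 + 2y) = 2•Λ₂(y)` (§5, PROVED) with `Λ₂` INTEGRAL — so the composite `Λ₂∘y∘ϑ` lives in `𝒪_ℂ⟦X⟧`, its value
at `z ∈ 𝔪_ℂ` is an `evS`-value, `evS` commutes with `subst` ON THE NOSE (tree `evS_subst`), and the only analysis left is
the Mercator series on the CLOSED ball `‖t‖ ≤ 1` with majorant `(d+1)2^{−d}` (§2, PROVED).  Sub-stubs:
* S1 PULLBACK₂            = R218a′ CHAIN-RULE₂ (k3-g39 `ComparisonChainRule`, SHARED input; not re-carded here);
* S4 = R221 «EVAL₂»        PROVED here (§2–§3, `read_value_eq_tsum_lamTerm` + `lambda_value_refl_evS` /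
                            `lambda_value_split_evS`): value of the reading witness = `½·plog θ Q(w)` (REFL) =
                            `plog θ g(w) − ½·plog θ g^φ(f′w)` (FROB) — no radius-1 theorem, no `LogOfEvalCommutes`;
* S3 TORSION-TRANSPORT₂    = R222 SHIFT₂ (REFL: `ϑ(ζ^{j+2^n}−1) = ϑ(ζ^j−1) [+] ω₁'`) resp. (16)+(18) (FROB:
                            `f′(ϑx) = ϑ^φ(f x)`, `f = (1+X)²−1`); XS, tree plumbing, typed in prose with decl names;
* S2 = R217 LOCAL-UNTWIST₂ value half PROVED here (§4, `evS_mapPt_eq_of_actsAsFrobPow`: semilinearity of `evS` under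
                            `algEquiv_evS`, every Frobenius offset); existence half = typed sub-stub `LocalUntwistExists`
                            (XS–S, pure Galois theory over `relRestrict`/`relGalOfUnit`);
* GLUE `read₂_of_cut`      PROVED (§1): the four value-table identities ⟹ `UnitReading` ⟹ `RamifiedReading` with
                            `V₁ := V + V₂∘cast` (REFL: `V₂ = const`; FROB: level-`n` junk killed downstream by k3-g38's
                            `sum_mulChar_mul_apply_castHom_eq_zero`) — the (7′) two-term split is bookkeeping.
Residual debt of R219 after this file: R218a′ (S⁻, shared) ⊕ `LocalUntwistExists` (XS–S) ⊕ S3 plumbing (XS) ⊕ the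
20-line instantiation of `read₂_of_cut`.  R221 leaves the debt vector.
-/

noncomputable section

open scoped PowerSeries.WithPiTopology

namespace Summit.BirchSwinnertonDyer.BirchSwinnertonDyer.Cruxes.SplitBadTwoLowerHalfOfFacts.ReadTwoCutK3G40

/-! ## §1. The glue (Mathlib-only, PROVED): READ₂ ⟸ one identity on units ⟸ the four sub-stub value identities -/

section Glue

variable {R' : Type*} [CommRing R'] {N : ℕ} [NeZero N]

/-- `RamifiedReading` — VERBATIM the consumer's input (k3-g38 `atom_shape`): two-term structure + unit covariance. -/
def RamifiedReading {M : ℕ} (hMN : M ∣ N) (V V₁ : ZMod N → R') (V₂ : ZMod M → R')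
    {Γ : Type*} (e : Γ ≃ (ZMod N)ˣ) (ℓ : Γ → R') : Prop :=
  (∀ j : ZMod N, V j = V₁ j - V₂ (ZMod.castHom hMN (ZMod M) j)) ∧ ∀ γ : Γ, V₁ (e γ : ZMod N) = ℓ γ

/-- **The content of READ₂ is ONE identity on units**: `V(eγ) + V₂(eγ mod M) = ℓ(γ)`. -/
def UnitReading {M : ℕ} (hMN : M ∣ N) (V : ZMod N → R') (V₂ : ZMod M → R')
    {Γ : Type*} (e : Γ ≃ (ZMod N)ˣ) (ℓ : Γ → R') : Prop :=
  ∀ γ : Γ, V (e γ : ZMod N) + V₂ (ZMod.castHom hMN (ZMod M) (e γ : ZMod N)) = ℓ γ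

/-- `UnitReading ⟹ RamifiedReading` with `V₁ := V + V₂ ∘ cast` (conjunct 1 becomes definitional). -/
theorem ramifiedReading_of_unitReading {M : ℕ} (hMN : M ∣ N) {V : ZMod N → R'} {V₂ : ZMod M → R'}
    {Γ : Type*} {e : Γ ≃ (ZMod N)ˣ} {ℓ : Γ → R'} (h : UnitReading hMN V V₂ e ℓ) :
    RamifiedReading hMN V (fun j => V j + V₂ (ZMod.castHom hMN (ZMod M) j)) V₂ e ℓ :=
  ⟨fun j => (add_sub_cancel_right _ _).symm, fun γ => h γ⟩

/-- … and conversely: ANY ramified reading yields the unit identity (so nothing is lost by the normal form). -/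
theorem unitReading_of_ramifiedReading {M : ℕ} (hMN : M ∣ N) {V V₁ : ZMod N → R'} {V₂ : ZMod M → R'}
    {Γ : Type*} {e : Γ ≃ (ZMod N)ˣ} {ℓ : Γ → R'} (h : RamifiedReading hMN V V₁ V₂ e ℓ) :
    UnitReading hMN V V₂ e ℓ := fun γ => by
  rw [h.1 (e γ : ZMod N), sub_add_cancel, h.2 γ]

/-- ★ **THE CUT GLUE `read₂_of_cut`.**  Value tables on `(ℤ/N)ˣ` (`N = 2^{n+1}`, `M = 2^n`):
`Λv a` = value of the primitive series `log̃ g_b ∘ ϑ` at `ζ^a − 1`; `Lg a = plog g_b(w_a)` (`w_a = ϑ(ζ^a−1)`);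
`Lφ m = plog g_b^φ(w'_m)` (`w'_{a mod M} = f′(w_a)`, level `n`); `T γ` = the untwisted table (`log` of `σ_γ(b_n)`).
S1 (pullback, up to the period `Ω⁻¹` and an additive constant) + S4 (Λ-split) + S3 (transport: the `½`-term factors
through `a mod M`) + S2 (untwist on units) ⟹ `UnitReading`, hence `RamifiedReading`. -/
theorem unitReading_of_cut {M : ℕ} (hMN : M ∣ N) {Γ : Type*} (e : Γ ≃ (ZMod N)ˣ)
    (V : ZMod N → R') (Λv Lg Lφ' : (ZMod N)ˣ → R') (Lφ : ZMod M → R') (T : Γ → R') (Ωinv half c : R')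
    (hS1 : ∀ a : (ZMod N)ˣ, V (a : ZMod N) = Ωinv * Λv a + c)
    (hS4 : ∀ a : (ZMod N)ˣ, Λv a = Lg a - half * Lφ' a)
    (hS3 : ∀ a : (ZMod N)ˣ, Lφ' a = Lφ (ZMod.castHom hMN (ZMod M) (a : ZMod N)))
    (hS2 : ∀ γ : Γ, Lg (e γ) = T γ) :
    UnitReading hMN V (fun m => Ωinv * half * Lφ m - c) e (fun γ => Ωinv * T γ) := fun γ => by
  simp only [hS1, hS4, hS3, hS2]
  ring

/-- READ₂ from the cut. -/
theorem read₂_of_cut {M : ℕ} (hMN : M ∣ N) {Γ : Type*} (e : Γ ≃ (ZMod N)ˣ)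
    (V : ZMod N → R') (Λv Lg Lφ' : (ZMod N)ˣ → R') (Lφ : ZMod M → R') (T : Γ → R') (Ωinv half c : R')
    (hS1 : ∀ a : (ZMod N)ˣ, V (a : ZMod N) = Ωinv * Λv a + c)
    (hS4 : ∀ a : (ZMod N)ˣ, Λv a = Lg a - half * Lφ' a)
    (hS3 : ∀ a : (ZMod N)ˣ, Lφ' a = Lφ (ZMod.castHom hMN (ZMod M) (a : ZMod N)))
    (hS2 : ∀ γ : Γ, Lg (e γ) = T γ) :
    RamifiedReading hMN V (fun j => V j + (Ωinv * half * Lφ (ZMod.castHom hMN (ZMod M) j) - c))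
      (fun m => Ωinv * half * Lφ m - c) e (fun γ => Ωinv * T γ) :=
  ramifiedReading_of_unitReading hMN (unitReading_of_cut hMN e V Λv Lg Lφ' Lφ T Ωinv half c hS1 hS4 hS3 hS2)

/-- ★ **THE CUT GLUE, REFL SHAPE (presentation of record, row 115: `V j = κ·(ℓ_j − ℓ_{j+s}) + c`, `s = 2^n`,
`V₂ = −c` CONSTANT).**  `Lg a = plog θ g_b(w_a)`; the shift `a ↦ a + s` is multiplication by a fixed `γ₀ ∈ Γ`
(`ζ^{a+2^n} = −ζ^a`, `γ₀ ↔ −1`); S1 (pullback + EVAL₂-REFL: `½·plog Q(w_a) = ½(ℓ_a − ℓ_{a+s})`) + S2 (untwist on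
units) ⟹ `RamifiedReading` with constant `V₂`. -/
theorem read₂_of_refl_cut {M : ℕ} (hMN : M ∣ N) {Γ : Type*} [Mul Γ] (e : Γ ≃ (ZMod N)ˣ)
    (V Lg : ZMod N → R') (T : Γ → R') (κ c : R') (s : ZMod N) (γ₀ : Γ)
    (hshift : ∀ γ : Γ, ((e (γ * γ₀) : (ZMod N)ˣ) : ZMod N) = (e γ : ZMod N) + s)
    (hS1 : ∀ a : ZMod N, V a = κ * (Lg a - Lg (a + s)) + c)
    (hS2 : ∀ γ : Γ, Lg (e γ : ZMod N) = T γ) :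
    RamifiedReading hMN V (fun j : ZMod N => V j + -c) (fun _ : ZMod M => -c) e
      (fun γ => κ * (T γ - T (γ * γ₀))) := by
  have h : UnitReading hMN V (fun _ : ZMod M => -c) e (fun γ => κ * (T γ - T (γ * γ₀))) := fun γ => by
    simp only [hS1, ← hshift, hS2]
    ring
  exact ramifiedReading_of_unitReading hMN h

end Glue

/-! ## §2. S4, the Λ-SPLIT at a point (PROVED, any complete ultrametric normed `ℚ₂`-algebra `𝕜`, e.g. `ℂ_[2]`):
`Λ₂(t) := Σ_{d≥0} (−1)^d 2^d t^{d+1}/(d+1) = ½·plog(1 + 2t)` CONVERGES on the CLOSED unit ball (`v₂(2^d/(d+1)) → ∞`),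
and `x² = y·(1 + 2t)` with `x, y` principal units ⟹ `Λ₂(t) = plog x − ½·plog y`.  Only `plog` homomorphy and the
defining Mercator series are used — this is the whole "log / evaluation commutation" of READ₂ at the value level. -/

section LambdaSplit

open Literature.NumberTheory.Transcendental

variable {𝕜 : Type*} [NontriviallyNormedField 𝕜] [NormedAlgebra ℚ_[2] 𝕜] [IsUltrametricDist 𝕜] [CompleteSpace 𝕜]

/-- `‖2‖ = ½` in a normed `ℚ₂`-algebra. -/
theorem norm_two : ‖(2 : 𝕜)‖ = 2⁻¹ := by
  have h := IwasawaLog.norm_natCast (F := 𝕜) 2 2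
  have hp : ‖((2 : ℕ) : ℚ_[2])‖ = ((2 : ℕ) : ℝ)⁻¹ := Padic.norm_p
  simp only [Nat.cast_ofNat] at h hp
  rw [h, hp]

theorem two_ne_zero' : (2 : 𝕜) ≠ 0 := by
  intro h
  have := norm_two (𝕜 := 𝕜)
  rw [h, norm_zero] at this
  norm_num at this

/-- The terms of `Λ₂` at `t`: `(−1)^d · 2^d/(d+1) · t^{d+1}` (`= logScalar 2 (d+1) · t^{d+1}` in k1-g37's notation). -/
def lamTerm (t : 𝕜) (d : ℕ) : 𝕜 := (-1) ^ d * (2 : 𝕜) ^ d / ((d : 𝕜) + 1) * t ^ (d + 1)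

/-- Term bound on the CLOSED unit ball: `‖lamTerm t d‖ ≤ (d+1)·2^{−d}`. -/
theorem norm_lamTerm_le {t : 𝕜} (ht : ‖t‖ ≤ 1) (d : ℕ) :
    ‖lamTerm t d‖ ≤ ((d : ℝ) + 1) * (2⁻¹ : ℝ) ^ d := by
  unfold lamTerm
  have hinv : ‖((d : 𝕜) + 1)⁻¹‖ ≤ (d : ℝ) + 1 := by
    have h := IwasawaLog.norm_inv_natCast_le (F := 𝕜) 2 (n := d + 1) (Nat.succ_ne_zero d)
    push_cast at h
    exact h
  rw [div_eq_mul_inv, norm_mul, norm_mul, norm_mul, norm_pow, norm_pow, norm_neg, norm_one, one_pow, one_mul,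
    norm_two, norm_pow]
  calc (2⁻¹ : ℝ) ^ d * ‖((d : 𝕜) + 1)⁻¹‖ * ‖t‖ ^ (d + 1)
      ≤ (2⁻¹ : ℝ) ^ d * ((d : ℝ) + 1) * 1 := by
        gcongr
        exact pow_le_one₀ (norm_nonneg _) ht
    _ = ((d : ℝ) + 1) * (2⁻¹ : ℝ) ^ d := by ring

/-- `Λ₂(t)` converges for `‖t‖ ≤ 1`. -/
theorem summable_lamTerm {t : 𝕜} (ht : ‖t‖ ≤ 1) : Summable (lamTerm t) := by
  have hr : ‖(2⁻¹ : ℝ)‖ < 1 := by rw [norm_inv, Real.norm_ofNat]; norm_num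
  have hg : Summable fun d : ℕ => ((d : ℝ) + 1) * (2⁻¹ : ℝ) ^ d := by
    have h1 : Summable fun d : ℕ => ((d : ℝ) ^ 1) * (2⁻¹ : ℝ) ^ d := summable_pow_mul_geometric_of_norm_lt_one 1 hr
    have h0 : Summable fun d : ℕ => (2⁻¹ : ℝ) ^ d := summable_geometric_of_norm_lt_one hr
    simpa [pow_one, add_mul] using h1.add h0
  exact Summable.of_norm_bounded hg (norm_lamTerm_le ht)

/-- `½ · plog(1 + 2t) = Σ' lamTerm t` (rescaling the defining Mercator series termwise). -/
theorem half_mul_plog_one_add_two_mul (t : 𝕜) :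
    (2 : 𝕜)⁻¹ * PadicExp.plog (1 + 2 * t) = ∑' d, lamTerm t d := by
  rw [Literature.NumberTheory.LocalFields.plog_one_add_eq_tsum, ← tsum_mul_left]
  refine tsum_congr fun d => ?_
  unfold lamTerm
  have h2 : (2 : 𝕜) ≠ 0 := two_ne_zero'
  rw [mul_pow, pow_succ (2 : 𝕜)]
  field_simp

/-- ★ `HasSum (lamTerm t) (½ · plog (1 + 2t))` on the closed unit ball. -/
theorem hasSum_lamTerm {t : 𝕜} (ht : ‖t‖ ≤ 1) :
    HasSum (lamTerm t) ((2 : 𝕜)⁻¹ * PadicExp.plog (1 + 2 * t)) := by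
  rw [half_mul_plog_one_add_two_mul]
  exact (summable_lamTerm ht).hasSum

/-- `plog (x² · y⁻¹) = 2·plog x − plog y` on principal units. -/
theorem plog_sq_mul_inv {x y : 𝕜} (hx : ‖1 - x‖ < 1) (hy : ‖1 - y‖ < 1) :
    PadicExp.plog (x ^ 2 * y⁻¹) = 2 * PadicExp.plog x - PadicExp.plog y := by
  rw [PadicExp.plog_mul (ℓ := 2) (IwasawaLog.norm_one_sub_pow_lt hx 2) (IwasawaLog.norm_one_sub_inv_lt hy),
    PadicExp.plog_pow (ℓ := 2) hx 2, PadicExp.plog_inv (ℓ := 2) hy]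
  push_cast
  ring

/-- `plog` of a quotient of principal units: `q·r = x ⟹ plog q = plog x − plog r` (REFL form: `Q_β · τ_E g = g`
evaluated at a point). -/
theorem plog_eq_sub_of_mul_eq {x q r : 𝕜} (hq : ‖1 - q‖ < 1) (hr : ‖1 - r‖ < 1) (h : q * r = x) :
    PadicExp.plog q = PadicExp.plog x - PadicExp.plog r := by
  rw [← h, PadicExp.plog_mul (ℓ := 2) hq hr]
  ring

/-- ★ **S4, REFL FORM (row 114's witness `½·logOf V_β`, `V_β ≡ 1 (mod 2)` by H6): `P = 1 + 2t` ⟹ `Λ₂(t) = ½·plog P`**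
— the defining Mercator series on the closed ball, nothing else. -/
theorem lambda_value_refl {P t : 𝕜} (ht : ‖t‖ ≤ 1) (hP : P = 1 + 2 * t) :
    ∑' d, lamTerm t d = (2 : 𝕜)⁻¹ * PadicExp.plog P := by
  rw [hP]
  exact (hasSum_lamTerm ht).tsum_eq

/-- ★★ **S4 — THE Λ-SPLIT AT A POINT.**  `x = g(w)`, `y = g^φ(f′w)` principal units, `t = y_g(w)` integral with the
EVALUATED congruence `x² = y(1 + 2t)` (a ring-hom image of k1-g37's `exists_unitRatio` datum), and `L` the value of the
convergent integral series `Λ₂ ∘ y_g` at `w` (§3 identifies it with `Σ' lamTerm t`): then `L = plog x − ½ plog y`. -/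
theorem lambda_value_split {x y t L : 𝕜} (hx : ‖1 - x‖ < 1) (hy : ‖1 - y‖ < 1) (ht : ‖t‖ ≤ 1)
    (hfac : x ^ 2 = y * (1 + 2 * t)) (hL : HasSum (lamTerm t) L) :
    L = PadicExp.plog x - (2 : 𝕜)⁻¹ * PadicExp.plog y := by
  have hy1 : ‖y‖ = 1 := IwasawaLog.norm_eq_one_of_norm_one_sub_lt hy
  have hy0 : y ≠ 0 := by
    intro h; rw [h, norm_zero] at hy1; exact zero_ne_one hy1
  have h2 : (2 : 𝕜) ≠ 0 := two_ne_zero'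
  have hquot : 1 + 2 * t = x ^ 2 * y⁻¹ := by
    rw [hfac]; field_simp
  rw [hL.unique (hasSum_lamTerm ht), hquot, plog_sq_mul_inv hx hy]
  field_simp

end LambdaSplit

/-! ## §3. The series side meets the value side in the TREE's currency (PROVED): values of composites / of integral
series at points of `𝔪_{ℂ_F}` are `evS`-values (`tsum_coeff_mul_pow_eq_evS`, `hasSum_map_coeff_mul_pow`) and
`evS` is an algebra hom commuting with substitution (`evS_subst`) — so "value of `Λ₂∘y∘ϑ` at `z`" = `Λ₂(y(ϑ(z)))`
and the congruence `g² = (g^φ∘f)(1+2y)` EVALUATES.  No analytic input. -/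

section TreeEvaluation

open ValuativeRel IsLocalRing Field
open Literature.NumberTheory.GaloisRepresentations Literature.NumberTheory.GaloisRepresentations.IsNonarchimedeanLocalField
  Literature.NumberTheory.GaloisRepresentations.LubinTate Literature.NumberTheory.PAdicHodge
  Literature.NumberTheory.EllipticCurves

variable {F : Type} [Field F] [ValuativeRel F] [TopologicalSpace F] [IsNonarchimedeanLocalField F]

attribute [local instance] ltNormUniformSpace ltNormIsUniformAddGroup rk1 nF nE fintypeResidueField

/-- ★ **SUBST–EVAL at a point of `𝔪_ℂ`, in `ℂ_F`**: the value of `R ∘ φ` at `z` is the value of `R` at `φ(z)`. -/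
theorem tsum_coeff_subst_mul_pow_eq (R φ : PowerSeries (CBall F)) (hφ : PowerSeries.constantCoeff φ = 0)
    (z : (maxNilIdealC F).toIdeal) :
    ∑' m : ℕ, ((PowerSeries.coeff m (PowerSeries.subst φ R) : CBall F) : CompletedAlgClosure F) *
        ((z : CBall F) : CompletedAlgClosure F) ^ m =
      ∑' d : ℕ, ((PowerSeries.coeff d R : CBall F) : CompletedAlgClosure F) *
        ((evS (maxNilIdealC F) z φ : CBall F) : CompletedAlgClosure F) ^ d := by
  have h := tsum_coeff_mul_pow_eq_evS R ⟨evS (maxNilIdealC F) z φ, evS_mem_of_constantCoeff_eq_zero _ z hφ⟩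
  rw [tsum_coeff_mul_pow_eq_evS, evS_subst (maxNilIdealC F) z hφ R]
  exact h.symm

/-- ★ the same pushed along `θ : ℂ_F → ℂ_2` (the currency of `prints_family_def_two`). -/
theorem tsum_coeff_map_subst_mul_pow_eq (θ : CompletedAlgClosure F →+* ℂ_[2]) (hθc : Continuous θ)
    (R φ : PowerSeries (CBall F)) (hφ : PowerSeries.constantCoeff φ = 0) (z : (maxNilIdealC F).toIdeal) :
    ∑' m : ℕ, PowerSeries.coeff m (PowerSeries.map (θ.comp (CBall F).subtype) (PowerSeries.subst φ R)) *
        (θ ((z : CBall F) : CompletedAlgClosure F)) ^ m =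
      ∑' d : ℕ, PowerSeries.coeff d (PowerSeries.map (θ.comp (CBall F).subtype) R) *
        (θ ((evS (maxNilIdealC F) z φ : CBall F) : CompletedAlgClosure F)) ^ d := by
  have h := (hasSum_map_coeff_mul_pow θ hθc R
    ⟨evS (maxNilIdealC F) z φ, evS_mem_of_constantCoeff_eq_zero _ z hφ⟩).tsum_eq
  rw [(hasSum_map_coeff_mul_pow θ hθc _ z).tsum_eq, evS_subst (maxNilIdealC F) z hφ R]
  exact h.symm

/-- Values of a principal series (`g(0) = 1`) at points of `𝔪_ℂ` are principal units of `ℂ_F`. -/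
theorem norm_one_sub_evS_lt_one (g : PowerSeries (CBall F)) (hg : PowerSeries.constantCoeff g = 1)
    (z : (maxNilIdealC F).toIdeal) :
    ‖(1 : CompletedAlgClosure F) - ((evS (maxNilIdealC F) z g : CBall F) : CompletedAlgClosure F)‖ < 1 := by
  have h0 : PowerSeries.constantCoeff (g - 1) = 0 := by rw [map_sub, hg, map_one, sub_self]
  have hmem : evS (maxNilIdealC F) z (g - 1) ∈ (maxNilIdealC F).toIdeal :=
    evS_mem_of_constantCoeff_eq_zero _ z h0
  have hlt : ‖((evS (maxNilIdealC F) z (g - 1) : CBall F) : CompletedAlgClosure F)‖ < 1 := hmem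
  have hval : ((evS (maxNilIdealC F) z g : CBall F) : CompletedAlgClosure F) =
      1 + ((evS (maxNilIdealC F) z (g - 1) : CBall F) : CompletedAlgClosure F) := by
    rw [map_sub, map_one]; push_cast; ring
  rw [hval, sub_add_cancel_left, norm_neg]
  exact hlt

/-- The congruence datum EVALUATES: `g² = G·(1 + 2y)` in `𝒪_ℂ⟦X⟧` ⟹ `g(z)² = G(z)·(1 + 2·y(z))`. -/
theorem evS_sq_eq_of_factorisation {g G y : PowerSeries (CBall F)}
    (h : g ^ 2 = G * (1 + PowerSeries.C (2 : CBall F) * y)) (z : (maxNilIdealC F).toIdeal) :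
    (evS (maxNilIdealC F) z g) ^ 2 = evS (maxNilIdealC F) z G * (1 + 2 * evS (maxNilIdealC F) z y) := by
  have := congrArg (evS (maxNilIdealC F) z) h
  simpa [map_pow, map_mul, map_add, map_one, evS_C] using this

/-- ★ **S4 ASSEMBLED IN THE TREE'S CURRENCY** (composite of §2 and §3): for principal `g, G ∈ 𝒪_ℂ⟦X⟧`, integral `y`
with `g² = G(1+2y)`, points `w` of `𝔪_ℂ`, and `θ : ℂ_F → ℂ_2` continuous, of norm `≤ 1` on `𝒪_ℂ` and mapping `𝔪_ℂ`
into the open unit ball (all three hold for the `θ` of record, `norm_equivPadicComplex_lt_one_iff`):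
the value `Σ' lamTerm (θ y(w))` IS `plog θ(g(w)) − ½ plog θ(G(w))`. -/
theorem lambda_value_split_evS (θ : CompletedAlgClosure F →+* ℂ_[2])
    (hθ1 : ∀ z : CBall F, ‖θ (z : CompletedAlgClosure F)‖ ≤ 1)
    (hθlt : ∀ x : CompletedAlgClosure F, ‖x‖ < 1 → ‖θ x‖ < 1)
    {g G y : PowerSeries (CBall F)} (hg : PowerSeries.constantCoeff g = 1) (hG : PowerSeries.constantCoeff G = 1)
    (h : g ^ 2 = G * (1 + PowerSeries.C (2 : CBall F) * y)) (w : (maxNilIdealC F).toIdeal) :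
    ∑' d, lamTerm (θ ((evS (maxNilIdealC F) w y : CBall F) : CompletedAlgClosure F)) d =
      Literature.NumberTheory.Transcendental.PadicExp.plog
          (θ ((evS (maxNilIdealC F) w g : CBall F) : CompletedAlgClosure F)) -
        (2 : ℂ_[2])⁻¹ * Literature.NumberTheory.Transcendental.PadicExp.plog
          (θ ((evS (maxNilIdealC F) w G : CBall F) : CompletedAlgClosure F)) := by
  have hx : ‖1 - θ ((evS (maxNilIdealC F) w g : CBall F) : CompletedAlgClosure F)‖ < 1 := by
    rw [← map_one θ, ← map_sub]; exact hθlt _ (norm_one_sub_evS_lt_one g hg w)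
  have hy : ‖1 - θ ((evS (maxNilIdealC F) w G : CBall F) : CompletedAlgClosure F)‖ < 1 := by
    rw [← map_one θ, ← map_sub]; exact hθlt _ (norm_one_sub_evS_lt_one G hG w)
  have ht : ‖θ ((evS (maxNilIdealC F) w y : CBall F) : CompletedAlgClosure F)‖ ≤ 1 := hθ1 _
  have hfac := congrArg (fun s : CBall F => θ (s : CompletedAlgClosure F)) (evS_sq_eq_of_factorisation h w)
  simp only [Subring.coe_mul, SubmonoidClass.coe_pow, Subring.coe_add, Subring.coe_one, map_mul, map_pow,
    map_add, map_one] at hfac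
  have h2 : θ (((2 : CBall F) : CBall F) : CompletedAlgClosure F) = 2 := by
    rw [show (((2 : CBall F) : CBall F) : CompletedAlgClosure F) = 2 by norm_cast, map_ofNat]
  rw [h2] at hfac
  exact lambda_value_split hx hy ht hfac (summable_lamTerm ht).hasSum

/-- ★ **S4 (REFL presentation of record) IN THE TREE'S CURRENCY**: for `P = 1 + 2y ∈ 𝒪_ℂ⟦X⟧` (`P =` the reflection
quotient `Q_β = g_β/τ_E g_β` normalised to `Q(0) = 1`; `Q_β ≡ 1 (mod π')` is k3-g39's PROVED `reflQuot_sub_one_mem` /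
`transportedCongruence_holds`) and `w ∈ 𝔪_ℂ`: `Σ' lamTerm (θ y(w)) = ½·plog θ(P(w))`.  With `tsum_coeff_map_subst_mul_pow_eq`
this is R221 «EVAL₂» for the witness `½·logOf P = Λ₂(y)` (`logOf_one_add_two_smul`, §5): NO `logOf`-evaluation API. -/
theorem lambda_value_refl_evS (θ : CompletedAlgClosure F →+* ℂ_[2])
    (hθ1 : ∀ z : CBall F, ‖θ (z : CompletedAlgClosure F)‖ ≤ 1)
    {P y : PowerSeries (CBall F)} (hP : P = 1 + PowerSeries.C (2 : CBall F) * y) (w : (maxNilIdealC F).toIdeal) :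
    ∑' d, lamTerm (θ ((evS (maxNilIdealC F) w y : CBall F) : CompletedAlgClosure F)) d =
      (2 : ℂ_[2])⁻¹ * Literature.NumberTheory.Transcendental.PadicExp.plog
          (θ ((evS (maxNilIdealC F) w P : CBall F) : CompletedAlgClosure F)) := by
  have ht : ‖θ ((evS (maxNilIdealC F) w y : CBall F) : CompletedAlgClosure F)‖ ≤ 1 := hθ1 _
  have hev : evS (maxNilIdealC F) w P = 1 + 2 * evS (maxNilIdealC F) w y := by
    have := congrArg (evS (maxNilIdealC F) w) hP
    simpa [map_mul, map_add, map_one, evS_C] using this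
  have hfac := congrArg (fun s : CBall F => θ (s : CompletedAlgClosure F)) hev
  simp only [Subring.coe_mul, Subring.coe_add, Subring.coe_one, map_mul, map_add, map_one] at hfac
  have h2 : θ (((2 : CBall F) : CBall F) : CompletedAlgClosure F) = 2 := by
    rw [show (((2 : CBall F) : CBall F) : CompletedAlgClosure F) = 2 by norm_cast, map_ofNat]
  rw [h2] at hfac
  exact lambda_value_refl ht hfac

/-- ★★ **R221 «EVAL₂» — THE VALUE OF THE READING WITNESS, CLOSED IN KERNEL.**  For any `L ∈ 𝒪_ℂ⟦X⟧` whose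
`θ`-coefficients are the `Λ₂` scalars (`θ[X⁰]L = 0`, `θ[X^{d+1}]L = (−1)^d 2^d/(d+1)`; existence: `coeff_Lam2_succ` + the
integrality `‖2^d/(d+1)‖₂ ≤ 1` of `norm_lamTerm_le`) and any `y ∈ 𝒪_ℂ⟦X⟧` with `y(0) = 0`, the `θ`-value at `z ∈ 𝔪_ℂ` of
the composite `L∘y` (the series the reading actually evaluates, after `∘ϑ` which is one more `tsum_coeff_map_subst_mul_pow_eq`)
is `Σ' lamTerm (θ y(z))` — hence `½·plog θ P(z)` (REFL, `lambda_value_refl_evS`) or `plog θ g(z) − ½·plog θ G(z)` (FROB,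
`lambda_value_split_evS`).  Ingredients: tree `evS_subst`, `hasSum_map_coeff_mul_pow`; one reindexing.  No `logOf`-evaluation
theorem, no radius-of-convergence bookkeeping. -/
theorem read_value_eq_tsum_lamTerm (θ : CompletedAlgClosure F →+* ℂ_[2]) (hθc : Continuous θ)
    (L y : PowerSeries (CBall F)) (hy : PowerSeries.constantCoeff y = 0)
    (hL0 : θ ((PowerSeries.coeff 0 L : CBall F) : CompletedAlgClosure F) = 0)
    (hL : ∀ d : ℕ, θ ((PowerSeries.coeff (d + 1) L : CBall F) : CompletedAlgClosure F) =
      (-1) ^ d * (2 : ℂ_[2]) ^ d / ((d : ℂ_[2]) + 1))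
    (z : (maxNilIdealC F).toIdeal) :
    ∑' m : ℕ, PowerSeries.coeff m (PowerSeries.map (θ.comp (CBall F).subtype) (PowerSeries.subst y L)) *
        (θ ((z : CBall F) : CompletedAlgClosure F)) ^ m =
      ∑' d : ℕ, lamTerm (θ ((evS (maxNilIdealC F) z y : CBall F) : CompletedAlgClosure F)) d := by
  rw [tsum_coeff_map_subst_mul_pow_eq θ hθc L y hy z]
  have hs := (hasSum_map_coeff_mul_pow θ hθc L
    ⟨evS (maxNilIdealC F) z y, evS_mem_of_constantCoeff_eq_zero _ z hy⟩).summable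
  rw [hs.tsum_eq_zero_add]
  simp only [PowerSeries.coeff_map, RingHom.coe_comp, Function.comp_apply, Subring.coe_subtype]
  rw [hL0, zero_mul, zero_add]
  refine tsum_congr fun d => ?_
  rw [hL d, lamTerm]

end TreeEvaluation

/-! ## §4. S2 = R217 LOCAL-UNTWIST₂ in the tree's RELATIVE currency (`exists_relColeman`):
the VALUE half is semilinearity (PROVED); the EXISTENCE half is the typed sub-stub `LocalUntwistExists`. -/

section LocalUntwist

open ValuativeRel IsLocalRing Field
open Literature.NumberTheory.GaloisRepresentations Literature.NumberTheory.GaloisRepresentations.IsNonarchimedeanLocalField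
  Literature.NumberTheory.GaloisRepresentations.LubinTate Literature.NumberTheory.PAdicHodge

variable {F : Type} [Field F] [ValuativeRel F] [TopologicalSpace F] [IsNonarchimedeanLocalField F]

attribute [local instance] ltNormUniformSpace ltNormIsUniformAddGroup rk1 nF nE fintypeResidueField

variable {π : 𝒪[F]} (hπ : (valuation F).IsUniformizer (π : F))
variable (E : IntermediateField F (AlgebraicClosure F)) [FiniteDimensional F E] [Normal F E]

/-- Coefficients of an iterated coefficient map. -/
theorem coeff_map_iterate {A : Type*} [CommSemiring A] (ψ : A →+* A) (k : ℕ) (g : PowerSeries A) (n : ℕ) :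
    PowerSeries.coeff n ((PowerSeries.map ψ)^[k] g) = ψ^[k] (PowerSeries.coeff n g) := by
  induction k generalizing g with
  | zero => rfl
  | succ k ih => rw [Function.iterate_succ_apply, ih, PowerSeries.coeff_map, ← Function.iterate_succ_apply ψ]

/-- "`τ ∈ Aut_F(E·K_π^{m+1})` acts on `𝒪_E` as `φ^K`" (`φ = frobUnitBall E σ₀`; `K` is NOT tied to the level). -/
def ActsAsFrobPow (σ₀ : absoluteGaloisGroup F) (K : ℕ) {m : ℕ}
    (τ : (E ⊔ ltField π m : IntermediateField F (AlgebraicClosure F)) ≃ₐ[F]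
      (E ⊔ ltField π m : IntermediateField F (AlgebraicClosure F))) : Prop :=
  ∀ x : unitBall E, τ (IntermediateField.inclusion le_sup_left (x : E)) =
    IntermediateField.inclusion le_sup_left
      (((((frobUnitBall E σ₀ : unitBall E ≃+* unitBall E) : unitBall E →+* unitBall E) :
        unitBall E → unitBall E)^[K] x : unitBall E) : E)

/-- ★ **S2, VALUE HALF (PROVED): the local untwist is semilinearity — for EVERY Frobenius offset `k`.**  If `g`
interpolates `β` in the sense of `exists_relColeman` (`((φ⁻¹)^{m+1} g)^ι(ι ω_{m+1}) = β_m`) and `τ` acts on `𝒪_E` as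
`φ^{m+1+k}`, then `(φ^k g)^ι(τ(ι ω_{m+1})) = τ(β_m)`: `k = 0` reads the level-`n+1` table of `g_b` itself (`Lg`),
`k = 1` the level-`n` table of `g_b^φ` (`Lφ`, the `½`-term of `log̃`), as Galois conjugates of table entries. -/
theorem evS_mapPt_eq_of_actsAsFrobPow (σ₀ : absoluteGaloisGroup F) (g : PowerSeries (unitBall E)) (m k : ℕ)
    (β : unitBall (E ⊔ ltField π m : IntermediateField F (AlgebraicClosure F)))
    (hg : evS (maxNilIdeal F (E ⊔ ltField π m : IntermediateField F (AlgebraicClosure F)))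
        (inclPt (le_sup_right : ltField π m ≤ E ⊔ ltField π m) (cohPt hπ m))
        (PowerSeries.map (inclUnitBall (F := F) (le_sup_left : E ≤ E ⊔ ltField π m) :
          unitBall E →+* unitBall (E ⊔ ltField π m : IntermediateField F (AlgebraicClosure F)))
          ((PowerSeries.map ((frobUnitBall E σ₀).symm : unitBall E →+* unitBall E))^[m + 1] g)) = β)
    (τ : (E ⊔ ltField π m : IntermediateField F (AlgebraicClosure F)) ≃ₐ[F]
      (E ⊔ ltField π m : IntermediateField F (AlgebraicClosure F)))
    (hτ : ActsAsFrobPow E σ₀ (m + 1 + k) τ) :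
    ((evS (maxNilIdeal F (E ⊔ ltField π m : IntermediateField F (AlgebraicClosure F)))
        (mapPt τ (inclPt (le_sup_right : ltField π m ≤ E ⊔ ltField π m) (cohPt hπ m)))
        (PowerSeries.map (inclUnitBall (F := F) (le_sup_left : E ≤ E ⊔ ltField π m) :
          unitBall E →+* unitBall (E ⊔ ltField π m : IntermediateField F (AlgebraicClosure F)))
          ((PowerSeries.map (frobUnitBall E σ₀ : unitBall E →+* unitBall E))^[k] g)) :
        unitBall (E ⊔ ltField π m : IntermediateField F (AlgebraicClosure F))) :
        (E ⊔ ltField π m : IntermediateField F (AlgebraicClosure F))) =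
      τ ((β : unitBall (E ⊔ ltField π m : IntermediateField F (AlgebraicClosure F))) :
        (E ⊔ ltField π m : IntermediateField F (AlgebraicClosure F))) := by
  -- the coefficient computation: `τ ∘ ι ∘ (φ⁻¹)^{m+1} = ι ∘ φ^k` on the coefficients of `g`
  have hfix : PowerSeries.map (toUnitBallHom τ : unitBall (E ⊔ ltField π m : IntermediateField F (AlgebraicClosure F)) →+*
        unitBall (E ⊔ ltField π m : IntermediateField F (AlgebraicClosure F)))
      (PowerSeries.map (inclUnitBall (F := F) (le_sup_left : E ≤ E ⊔ ltField π m) :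
          unitBall E →+* unitBall (E ⊔ ltField π m : IntermediateField F (AlgebraicClosure F)))
        ((PowerSeries.map ((frobUnitBall E σ₀).symm : unitBall E →+* unitBall E))^[m + 1] g)) =
      PowerSeries.map (inclUnitBall (F := F) (le_sup_left : E ≤ E ⊔ ltField π m) :
          unitBall E →+* unitBall (E ⊔ ltField π m : IntermediateField F (AlgebraicClosure F)))
        ((PowerSeries.map (frobUnitBall E σ₀ : unitBall E →+* unitBall E))^[k] g) := by
    refine PowerSeries.ext fun n => ?_
    rw [PowerSeries.coeff_map, PowerSeries.coeff_map, PowerSeries.coeff_map, coeff_map_iterate, coeff_map_iterate]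
    refine Subtype.ext ?_
    have hcancel : ∀ c : unitBall E,
        (((frobUnitBall E σ₀ : unitBall E ≃+* unitBall E) : unitBall E →+* unitBall E) :
            unitBall E → unitBall E)^[m + 1]
          (((((frobUnitBall E σ₀).symm : unitBall E ≃+* unitBall E) : unitBall E →+* unitBall E) :
            unitBall E → unitBall E)^[m + 1] c) = c :=
      Function.LeftInverse.iterate
        (g := (((frobUnitBall E σ₀ : unitBall E ≃+* unitBall E) : unitBall E →+* unitBall E) :
            unitBall E → unitBall E))
        (f := ((((frobUnitBall E σ₀).symm : unitBall E ≃+* unitBall E) : unitBall E →+* unitBall E) :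
            unitBall E → unitBall E))
        (fun x => by simpa using (frobUnitBall E σ₀).apply_symm_apply x) (m + 1)
    have h1 := hτ (((((frobUnitBall E σ₀).symm : unitBall E ≃+* unitBall E) : unitBall E →+* unitBall E) :
            unitBall E → unitBall E)^[m + 1] (PowerSeries.coeff n g))
    rw [show m + 1 + k = k + (m + 1) from Nat.add_comm _ _] at h1
    rw [Function.iterate_add_apply _ k (m + 1), hcancel] at h1
    exact h1
  have key := algEquiv_evS (E ⊔ ltField π m : IntermediateField F (AlgebraicClosure F)) τ
    (PowerSeries.map (inclUnitBall (F := F) (le_sup_left : E ≤ E ⊔ ltField π m) :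
        unitBall E →+* unitBall (E ⊔ ltField π m : IntermediateField F (AlgebraicClosure F)))
      ((PowerSeries.map ((frobUnitBall E σ₀).symm : unitBall E →+* unitBall E))^[m + 1] g))
    (inclPt (le_sup_right : ltField π m ≤ E ⊔ ltField π m) (cohPt hπ m))
  rw [hfix, hg] at key
  rw [← key, coe_toUnitBallHom]

/-- **S2, EXISTENCE HALF = the typed sub-stub `LocalUntwistExists` (R217; XS–S, pure Galois bookkeeping):** for every
level `m`, Frobenius exponent `K` and unit `v ∈ 𝒪_F^×` there is `τ ∈ Aut_F(E·K_π^{m+1})` acting on `𝒪_E` as `φ^K` and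
moving `ι ω_{m+1}` exactly as `σ_v = relGalOfUnit v` does (`σ_v` fixes `E` and multiplies the torsion by `v`,
`mapPt_relGalOfUnit_relAct`).  Expected proof: `τ := relRestrict (σ₀^K · σ')` with `σ'` from
`exists_absGal_fixing_smul_ltRoot_eq` for the unit `v · χ_π(σ₀)^{-K}` (`E/F` unramified and `K_π^{m+1}/F` totally
ramified are linearly disjoint: `Gal(E·K_π^{m+1}/F) = Gal(E/F) × Gal(K_π^{m+1}/F)`). -/
def LocalUntwistExists (hE : E ≤ maxUnramified F) (σ₀ : absoluteGaloisGroup F) : Prop :=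
  ∀ (m K : ℕ) (v : 𝒪[F]ˣ), ∃ τ : (E ⊔ ltField π m : IntermediateField F (AlgebraicClosure F)) ≃ₐ[F]
      (E ⊔ ltField π m : IntermediateField F (AlgebraicClosure F)),
    ActsAsFrobPow E σ₀ K τ ∧
      mapPt τ (inclPt (le_sup_right : ltField π m ≤ E ⊔ ltField π m) (cohPt hπ m)) =
        mapPt (relGalOfUnit hπ E m hE v) (inclPt (le_sup_right : ltField π m ≤ E ⊔ ltField π m) (cohPt hπ m))

/-- ★ **S2 assembled: the UNTWISTED VALUE TABLES.**  Under `LocalUntwistExists`, for every unit `v` and offset `k` the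
value of `φ^k g` at the primitive point `σ_v(ι ω_{m+1})` is a Galois conjugate `τ(β_m)` with `τ|_{𝒪_E} = φ^{m+1+k}` —
the tables `Lg` (`k = 0`, level `n+1`) and `Lφ` (`k = 1`, level `n`) of §1, whose `plog ∘ θ` the seam
(`LogDerivSeam`, k3-g38; RCF) turns into `log σ_γ(b)`-tables. -/
theorem exists_untwisted_table (hE : E ≤ maxUnramified F) (σ₀ : absoluteGaloisGroup F)
    (hex : LocalUntwistExists hπ E hE σ₀) (g : PowerSeries (unitBall E)) (m k : ℕ)
    (β : unitBall (E ⊔ ltField π m : IntermediateField F (AlgebraicClosure F)))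
    (hg : evS (maxNilIdeal F (E ⊔ ltField π m : IntermediateField F (AlgebraicClosure F)))
        (inclPt (le_sup_right : ltField π m ≤ E ⊔ ltField π m) (cohPt hπ m))
        (PowerSeries.map (inclUnitBall (F := F) (le_sup_left : E ≤ E ⊔ ltField π m) :
          unitBall E →+* unitBall (E ⊔ ltField π m : IntermediateField F (AlgebraicClosure F)))
          ((PowerSeries.map ((frobUnitBall E σ₀).symm : unitBall E →+* unitBall E))^[m + 1] g)) = β)
    (v : 𝒪[F]ˣ) :
    ∃ τ : (E ⊔ ltField π m : IntermediateField F (AlgebraicClosure F)) ≃ₐ[F]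
        (E ⊔ ltField π m : IntermediateField F (AlgebraicClosure F)),
      ActsAsFrobPow E σ₀ (m + 1 + k) τ ∧
      ((evS (maxNilIdeal F (E ⊔ ltField π m : IntermediateField F (AlgebraicClosure F)))
          (mapPt (relGalOfUnit hπ E m hE v) (inclPt (le_sup_right : ltField π m ≤ E ⊔ ltField π m) (cohPt hπ m)))
          (PowerSeries.map (inclUnitBall (F := F) (le_sup_left : E ≤ E ⊔ ltField π m) :
            unitBall E →+* unitBall (E ⊔ ltField π m : IntermediateField F (AlgebraicClosure F)))
            ((PowerSeries.map (frobUnitBall E σ₀ : unitBall E →+* unitBall E))^[k] g)) :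
          unitBall (E ⊔ ltField π m : IntermediateField F (AlgebraicClosure F))) :
          (E ⊔ ltField π m : IntermediateField F (AlgebraicClosure F))) =
        τ ((β : unitBall (E ⊔ ltField π m : IntermediateField F (AlgebraicClosure F))) :
          (E ⊔ ltField π m : IntermediateField F (AlgebraicClosure F))) := by
  obtain ⟨τ, hτ, hpt⟩ := hex m (m + 1 + k) v
  exact ⟨τ, hτ, by rw [← hpt]; exact evS_mapPt_eq_of_actsAsFrobPow hπ E σ₀ g m k β hg τ hτ⟩

end LocalUntwist

/-! ## §5. G2, the SERIES identity (PROVED, any ℚ-algebra): the reading witness of a series `≡ 1 (mod 2)` IS `Λ₂` of an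
integral series — `logOf (1 + 2y) = 2 • Λ₂(y)`, `Λ₂ = ½·log(1 + 2X) ∈ ℤ₂⟦X⟧` (`2^{n−1}/n ∈ ℤ₂`).  This is what puts
R221 «EVAL₂» inside the tree's INTEGRAL evaluation calculus (`evS`, `evS_subst`): the outer series of the composite is
`Λ₂` (integral), never Mercator's `log(1+X)` (coefficients `1/n`, unbounded). -/

section SeriesIdentity

open PowerSeries

variable (A : Type*) [CommRing A] [Algebra ℚ A]

/-- `Λ₂ := ½·log(1 + 2X) = Σ_{n ≥ 1} (−1)^{n+1} 2^{n−1}/n · X^n`. -/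
def Lam2 : PowerSeries A :=
  PowerSeries.mk fun n => if n = 0 then 0 else algebraMap ℚ A ((-1 : ℚ) ^ (n + 1) * 2 ^ (n - 1) / n)

variable {A}

theorem coeff_Lam2 (n : ℕ) :
    coeff n (Lam2 A) = if n = 0 then 0 else algebraMap ℚ A ((-1 : ℚ) ^ (n + 1) * 2 ^ (n - 1) / n) :=
  coeff_mk _ _

theorem constantCoeff_Lam2 : constantCoeff (Lam2 A) = 0 := by
  simp [← coeff_zero_eq_constantCoeff_apply, coeff_Lam2]

/-- `2 • Λ₂ = log(1 + 2X) = rescale 2 (log A)`. -/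
theorem two_smul_Lam2 : (2 : A) • Lam2 A = rescale (2 : A) (log A) := by
  ext n
  rw [coeff_smul, coeff_rescale, coeff_Lam2, coeff_log]
  split_ifs with h
  · simp
  · obtain ⟨k, rfl⟩ := Nat.exists_eq_succ_of_ne_zero h
    rw [smul_eq_mul, show (2 : A) = algebraMap ℚ A 2 from (map_ofNat (algebraMap ℚ A) 2).symm, ← map_pow,
      ← map_mul, ← map_mul, Nat.succ_eq_add_one, Nat.add_sub_cancel]
    congr 1
    rw [pow_succ]
    ring

/-- ★ **G2 (PROVED): `logOf (1 + 2y) = 2 • Λ₂(y)` for `y(0) = 0`.** -/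
theorem logOf_one_add_two_smul {y : A⟦X⟧} (hy : constantCoeff y = 0) :
    logOf (1 + (2 : A) • y) = (2 : A) • (Lam2 A).subst y := by
  have hyS : HasSubst y := HasSubst.of_constantCoeff_zero' hy
  have h2X : HasSubst ((2 : A) • X : A⟦X⟧) := HasSubst.smul_X' 2
  rw [logOf_eq, add_sub_cancel_left, ← subst_smul hyS, two_smul_Lam2, rescale_eq_subst,
    subst_comp_subst_apply h2X hyS, subst_smul hyS, subst_X hyS]

/-- The coefficients of `Λ₂` ARE the `lamTerm` scalars: `coeff (d+1) Λ₂ = (−1)^d 2^d/(d+1)` — so the `evS`-value of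
`Λ₂(y)` at `w` (`tsum_coeff_subst_mul_pow_eq`: `= Σ_n coeff n Λ₂ · y(w)^n`) is `Σ' lamTerm (y(w))` after `θ`. -/
theorem coeff_Lam2_succ (d : ℕ) :
    coeff (d + 1) (Lam2 A) = algebraMap ℚ A ((-1 : ℚ) ^ d * 2 ^ d / (d + 1)) := by
  rw [coeff_Lam2, if_neg (Nat.succ_ne_zero d), Nat.add_sub_cancel]
  congr 1
  push_cast
  ring

/-- G3a (PROVED): `logOf` commutes with substitution — `logOf (Q∘φ) = (logOf Q)∘φ`. -/
theorem logOf_subst {Q φ : A⟦X⟧} (hQ : constantCoeff Q = 1) (hφ : constantCoeff φ = 0) :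
    logOf (Q.subst φ) = (logOf Q).subst φ := by
  have hφS : HasSubst φ := HasSubst.of_constantCoeff_zero' hφ
  have hQ1 : HasSubst (Q - 1 : A⟦X⟧) := HasSubst.of_constantCoeff_zero' (by simp [hQ])
  rw [logOf_eq, logOf_eq, subst_comp_subst_apply hQ1 hφS]
  congr 1
  rw [← coe_substAlgHom hφS, map_sub, map_one]

/-- G3b (PROVED): `logOf` commutes with `map` along a ring hom (the transport `j`, then `Θ`). -/
theorem logOf_map {B : Type*} [CommRing B] [Algebra ℚ B] (h : A →+* B) {Q : A⟦X⟧}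
    (hQ : constantCoeff Q = 1) : logOf (Q.map h) = (logOf Q).map h := by
  have hQ1 : HasSubst (Q - 1 : A⟦X⟧) := HasSubst.of_constantCoeff_zero' (by simp [hQ])
  rw [logOf_eq, logOf_eq]
  change _ = MvPowerSeries.map h (PowerSeries.subst (Q - 1) (log A))
  rw [map_subst hQ1, map_log]
  congr 1
  change _ = PowerSeries.map h (Q - 1)
  rw [map_sub, map_one]

end SeriesIdentity

end Summit.BirchSwinnertonDyer.BirchSwinnertonDyer.Cruxes.SplitBadTwoLowerHalfOfFacts.ReadTwoCutK3G40

end
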